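import Mathlib
import Summits.ResolutionOfSingularities.ResolutionOfSingularities.Theorems.HomologicalConductorPersistenceConductorFloor
import HarnessLib

/-!
# Rung S-2 `PersistenceSurface` (stmt-ResolutionOfSingularities-19970) — the CONDUCTOR FLOOR WITHOUT the
# principal hypothesis, I: `W(Bⁿ) ≅ 𝔠ⁿ` for every conductor; `𝔠` projective ⇒ `𝔠²·ca³(C) ⊆ ca³(B)`

Route `ResolutionOfSingularities/HomologicalConductor`, chain W4.4b (cell `res-hironaka`), rung S-2
`PersistenceSurface` (stmt-ResolutionOfSingularities-19970), registered stub
`stub_levelFourPersistenceNonnormalOrNonrational'` (L-other′; class Σ8 = NON-NORMAL stage `0`), cell R5 / S-c.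
Seat res-L1-w44b-stub-3 (gen 7), taking res-L1-w44b-lead-1's «kernel next (anyone)» item (i) of `S2-LEAD-g3.md` §4
(«the non-principal floor: `𝔠` invertible, `W(B) ≅ 𝔠` projective»).  Continues `…PersistenceConductorCeiling`
(p550697: `ca³(B) ⊆ 𝔠`), `…PersistenceConductorCoextension` (p551581: the transfer through `W = Hom_B(C, –)`) and
`…PersistenceConductorFloor` (p552596: the floor for a PRINCIPAL conductor `𝔠 = a·C`).  `[OURS · L1 w44b]`;
folklore module theory; NOT a statement of the manuscript under review (Hironaka 2017) and no statement of that
manuscript is used; AI-written, weaker than expert review.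

## Setting

`B → C` an injective map of commutative rings, `C` a domain, BIRATIONAL (`∀ γ ∃ b ≠ 0, bγ ∈ B`); the CONDUCTOR
is handed over as an ideal `𝔠` of `C` together with its defining property `h𝔠 : γ ∈ 𝔠 ↔ ∀ δ, γδ ∈ B`
(no definition is introduced; conductor ELEMENTS `c ∈ B` are those with `c·C ⊆ B`, as in p551581/p552596).
`W(X) = Hom_B(C|_B, X)` with its coextended `C`-structure (Mathlib `ModuleCat.CoextendScalars`, spelled
`((ModuleCat.restrictScalars (algebraMap B C)).obj (ModuleCat.of C C)) →ₗ[B] X`).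

## Results

* `exists_linearEquiv_coext_pi_conductor` — **`W(Bⁿ) ≅ 𝔠ⁿ` as `C`-modules for EVERY conductor**
  (`θ ↦ (θᵢ(1))ᵢ`; a `B`-linear `θ : C → B` is `γ ↦ γ·θ(1)`, p552596's `algebraMap_apply_eq_mul`, so
  `θ(1) ∈ 𝔠`).  p552596's `exists_linearEquiv_coext_pi` is the case `𝔠 = aC ≅ C`.
* `exists_coext_retract_pi_conductor`, `finite_coext` — `W(P)` is a retract of some `𝔠ⁿ`, hence finitely
  generated (`C` noetherian), for `P` finitely generated projective over `B`.
* `finite_projective_coext_of_projective` — if `𝔠` is a PROJECTIVE `C`-module (e.g. an invertible ideal)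
  then `W(P)` is finitely generated projective.
* `exists_isSyzygy_two_coext_of`, `exists_coext_factor_of_mem_cohomologyAnnihilatorOfDegree_three_of`,
  `mul_mem_cohomologyAnnihilatorOfDegree_three_of_conductor_of` — p552596's chain (`W(K)` is a second
  `C`-syzygy; every `y ∈ ca³(C)` factors on `W(K)`; the floor `c·(c'y) ∈ ca³(B)`) re-run from the single
  hypothesis «`W` preserves finitely generated projectives» instead of «`𝔠` principal» (proofs adapted from
  p552596, res-L1-w44b-lead-1).
* **`mul_mem_cohomologyAnnihilatorOfDegree_three_of_conductor_of_projective`** — THE FLOOR FOR A PROJECTIVE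
  CONDUCTOR: `c·(c'y) ∈ ca³(B)` for conductor elements `c, c'` and `y ∈ ca³(C)`, i.e. `𝔠²·ca³(C) ⊆ ca³(B)`.

The sequel `…PersistenceConductorFloorSyzygy` treats a conductor that is only a second `C`-syzygy (e.g.
reflexive): `𝔠²·(ca³(C))³ ⊆ ca³(B)`.  With p550697's ceiling: `𝔠²·ca³(T̄₀) ⊆ ca³(T₀) ⊆ 𝔠` for a non-normal
stage `T₀ ⊂ T̄₀` whose conductor is invertible on `T̄₀`.

References (mechanism only): S. B. Iyengar, R. Takahashi, IMRN 2016, Remark 2.13 [`IyengarTakahashi2014`];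
coextension of scalars and `Hom_B(C, B) ≅ 𝔠` are folklore.
-/

-- single-problem summit: the doubled namespace component `ResolutionOfSingularities` is forced
set_option linter.dupNamespace false

noncomputable section

open CategoryTheory CategoryTheory.Abelian Literature.RingTheory.CohomologyAnnihilator
open Summit.ResolutionOfSingularities.ResolutionOfSingularities.Theorems.NoZeno.SandwichCluster
open Summit.ResolutionOfSingularities.ResolutionOfSingularities.Theorems.HomologicalConductor.PersistenceCyclicTransferSyzygy
  (isSyzygy_two_ker)
open Summit.ResolutionOfSingularities.ResolutionOfSingularities.Theorems.HomologicalConductor.PersistenceConductorCoextension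
  (stablyAnnihilates_of_coextension_factor)
open Summit.ResolutionOfSingularities.ResolutionOfSingularities.Theorems.HomologicalConductor.PersistenceConductorFloor
  (algebraMap_apply_eq_mul exists_linearEquiv_coext_ker)

universe u

namespace Summit.ResolutionOfSingularities.ResolutionOfSingularities.Theorems.HomologicalConductor.PersistenceConductorFloorGeneral

variable {B C : Type u} [CommRing B] [CommRing C] [Algebra B C]


/-! ## `W(Bⁿ) ≅ 𝔠ⁿ` for every conductor -/

/-- **`W(Bⁿ) = Hom_B(C, Bⁿ) ≅ 𝔠ⁿ` as `C`-modules, for EVERY conductor.**  `B → C` injective and birational,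
`C` a domain, `𝔠 ⊆ C` the conductor (`γ ∈ 𝔠 ↔ γ·C ⊆ B`): `θ ↦ (θᵢ(1))ᵢ`, with inverse
`v ↦ (γ ↦ (γ·vᵢ)ᵢ)` (the unique preimages in `B`).  [folklore] -/
theorem exists_linearEquiv_coext_pi_conductor [IsDomain C] (hinj : Function.Injective (algebraMap B C))
    (hbir : ∀ γ : C, ∃ b : B, b ≠ 0 ∧ ∃ b' : B, algebraMap B C b' = algebraMap B C b * γ)
    (𝔠 : Ideal C) (h𝔠 : ∀ γ : C, γ ∈ 𝔠 ↔ ∀ δ : C, ∃ b : B, algebraMap B C b = γ * δ) (n : ℕ) :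
    Nonempty ((((ModuleCat.restrictScalars (algebraMap B C)).obj (ModuleCat.of C C)) →ₗ[B] (Fin n → B))
      ≃ₗ[C] (Fin n → ↥𝔠)) := by
  classical
  let toW : C → ((ModuleCat.restrictScalars (algebraMap B C)).obj (ModuleCat.of C C)) := fun v => v
  let ofW : ((ModuleCat.restrictScalars (algebraMap B C)).obj (ModuleCat.of C C)) → C := fun w => w
  have ofW_smul : ∀ (r : B) (w : ((ModuleCat.restrictScalars (algebraMap B C)).obj (ModuleCat.of C C))),
      ofW (r • w) = algebraMap B C r * ofW w := fun r w => by
    rw [ModuleCat.restrictScalars.smul_def (M := ModuleCat.of C C)]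
    rfl
  have smul_apply'' : ∀ (s : C)
      (θ : ((ModuleCat.restrictScalars (algebraMap B C)).obj (ModuleCat.of C C)) →ₗ[B] (Fin n → B)) (w),
      (s • θ) w = θ (toW (ofW w * s)) := fun _ _ _ => rfl
  -- the components `θᵢ : C|_B → B` are `γ ↦ γ·θᵢ(1)`, so `θᵢ(1) ∈ 𝔠`
  have hcomp : ∀ (θ : ((ModuleCat.restrictScalars (algebraMap B C)).obj (ModuleCat.of C C)) →ₗ[B]
      (Fin n → B)) (i : Fin n) (γ : C),
      algebraMap B C (θ (toW γ) i) = γ * algebraMap B C (θ (toW 1) i) := fun θ i γ =>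
    algebraMap_apply_eq_mul hinj hbir ((LinearMap.proj i).comp θ) γ
  have hmem : ∀ (θ : ((ModuleCat.restrictScalars (algebraMap B C)).obj (ModuleCat.of C C)) →ₗ[B]
      (Fin n → B)) (i : Fin n), algebraMap B C (θ (toW 1) i) ∈ 𝔠 := fun θ i =>
    (h𝔠 _).mpr fun δ => ⟨θ (toW δ) i, by rw [hcomp, mul_comm]⟩
  -- `Φ θ = (θᵢ(1))ᵢ`
  let Φ : (((ModuleCat.restrictScalars (algebraMap B C)).obj (ModuleCat.of C C)) →ₗ[B] (Fin n → B))
      →ₗ[C] (Fin n → ↥𝔠) :=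
    { toFun := fun θ i => ⟨algebraMap B C (θ (toW 1) i), hmem θ i⟩
      map_add' := fun θ θ' => by
        ext i
        simp only [LinearMap.add_apply, Pi.add_apply, map_add, Submodule.coe_add]
      map_smul' := fun s θ => by
        ext i
        change algebraMap B C ((s • θ) (toW 1) i) = s * algebraMap B C (θ (toW 1) i)
        rw [smul_apply'']
        change algebraMap B C (θ (toW (1 * s)) i) = _
        rw [one_mul, hcomp] }
  -- the inverse: `v ↦ (γ ↦ (pre (vᵢ) γ)ᵢ)`, `pre x δ` the preimage of `x·δ`
  have hpre : ∀ (x : ↥𝔠) (δ : C), ∃ b : B, algebraMap B C b = (x : C) * δ := fun x δ =>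
    (h𝔠 _).mp x.2 δ
  choose pre hpre using hpre
  let Ψ : (Fin n → ↥𝔠) → (((ModuleCat.restrictScalars (algebraMap B C)).obj (ModuleCat.of C C)) →ₗ[B]
      (Fin n → B)) := fun v =>
    { toFun := fun γ i => pre (v i) (ofW γ)
      map_add' := fun γ δ => by
        ext i
        apply hinj
        change algebraMap B C (pre (v i) (ofW γ + ofW δ)) = _
        rw [Pi.add_apply, map_add, hpre, hpre, hpre, mul_add]
      map_smul' := fun r γ => by
        ext i
        apply hinj
        rw [RingHom.id_apply, Pi.smul_apply, hpre, ofW_smul, smul_eq_mul, map_mul, hpre]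
        ring }
  have hΨ : ∀ v γ i, Ψ v γ i = pre (v i) (ofW γ) := fun _ _ _ => rfl
  have hΦΨ : ∀ v, Φ (Ψ v) = v := by
    intro v
    ext i
    change algebraMap B C (Ψ v (toW 1) i) = (v i : C)
    rw [hΨ, hpre]
    change (v i : C) * 1 = _
    rw [mul_one]
  have hΨΦ : ∀ θ, Ψ (Φ θ) = θ := by
    intro θ
    apply LinearMap.ext
    intro γ
    ext i
    apply hinj
    rw [hΨ, hpre]
    change algebraMap B C (θ (toW 1) i) * ofW γ = algebraMap B C (θ (toW (ofW γ)) i)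
    rw [hcomp θ i (ofW γ), mul_comm]
  exact ⟨LinearEquiv.ofBijective Φ ⟨fun θ θ' h => by rw [← hΨΦ θ, ← hΨΦ θ', h],
    fun v => ⟨Ψ v, hΦΨ v⟩⟩⟩

/-! ## `W(P)` is a retract of some `𝔠ⁿ`; finiteness; projectivity for a projective conductor -/

/-- **`W(P)` is a retract of `𝔠ⁿ`** for `P` finitely generated projective over `B` (any conductor):
`P` is a retract of `Bⁿ`, apply `W` and `W(Bⁿ) ≅ 𝔠ⁿ`. [folklore] -/
theorem exists_coext_retract_pi_conductor [IsDomain C] (hinj : Function.Injective (algebraMap B C))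
    (hbir : ∀ γ : C, ∃ b : B, b ≠ 0 ∧ ∃ b' : B, algebraMap B C b' = algebraMap B C b * γ)
    (𝔠 : Ideal C) (h𝔠 : ∀ γ : C, γ ∈ 𝔠 ↔ ∀ δ : C, ∃ b : B, algebraMap B C b = γ * δ)
    (P : Type u) [AddCommGroup P] [Module B P] [Module.Finite B P] [Module.Projective B P] :
    ∃ (n : ℕ)
      (i : (((ModuleCat.restrictScalars (algebraMap B C)).obj (ModuleCat.of C C)) →ₗ[B] P) →ₗ[C]
        (Fin n → ↥𝔠))
      (p : (Fin n → ↥𝔠) →ₗ[C] (((ModuleCat.restrictScalars (algebraMap B C)).obj (ModuleCat.of C C))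
        →ₗ[B] P)),
      ∀ θ, p (i θ) = θ := by
  obtain ⟨n, q, hq⟩ := Module.Finite.exists_fin' B P
  obtain ⟨sec, hsec⟩ := Module.projective_lifting_property q (LinearMap.id : P →ₗ[B] P) hq
  obtain ⟨e⟩ := exists_linearEquiv_coext_pi_conductor hinj hbir 𝔠 h𝔠 n
  let Wq : (((ModuleCat.restrictScalars (algebraMap B C)).obj (ModuleCat.of C C)) →ₗ[B] (Fin n → B)) →ₗ[C]
      (((ModuleCat.restrictScalars (algebraMap B C)).obj (ModuleCat.of C C)) →ₗ[B] P) :=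
    { toFun := fun θ => q ∘ₗ θ
      map_add' := fun θ θ' => LinearMap.comp_add _ _ _
      map_smul' := fun s θ => by apply LinearMap.ext; intro w; rfl }
  let Ws : (((ModuleCat.restrictScalars (algebraMap B C)).obj (ModuleCat.of C C)) →ₗ[B] P) →ₗ[C]
      (((ModuleCat.restrictScalars (algebraMap B C)).obj (ModuleCat.of C C)) →ₗ[B] (Fin n → B)) :=
    { toFun := fun θ => sec ∘ₗ θ
      map_add' := fun θ θ' => LinearMap.comp_add _ _ _
      map_smul' := fun s θ => by apply LinearMap.ext; intro w; rfl }
  have hWqs : ∀ θ, Wq (Ws θ) = θ := by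
    intro θ
    apply LinearMap.ext
    intro w
    change q (sec (θ w)) = θ w
    rw [← LinearMap.comp_apply, hsec, LinearMap.id_apply]
  refine ⟨n, e.toLinearMap ∘ₗ Ws, Wq ∘ₗ e.symm.toLinearMap, fun θ => ?_⟩
  simp only [LinearMap.coe_comp, LinearEquiv.coe_coe, Function.comp_apply, LinearEquiv.symm_apply_apply]
  exact hWqs θ

/-- **`W(P)` is finitely generated over `C`** for `P` finitely generated projective over `B` and `C` noetherian
(any conductor). [folklore] -/
theorem finite_coext [IsDomain C] [IsNoetherianRing C] (hinj : Function.Injective (algebraMap B C))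
    (hbir : ∀ γ : C, ∃ b : B, b ≠ 0 ∧ ∃ b' : B, algebraMap B C b' = algebraMap B C b * γ)
    (𝔠 : Ideal C) (h𝔠 : ∀ γ : C, γ ∈ 𝔠 ↔ ∀ δ : C, ∃ b : B, algebraMap B C b = γ * δ)
    (P : Type u) [AddCommGroup P] [Module B P] [Module.Finite B P] [Module.Projective B P] :
    Module.Finite C (((ModuleCat.restrictScalars (algebraMap B C)).obj (ModuleCat.of C C)) →ₗ[B] P) := by
  obtain ⟨n, i, p, h⟩ := exists_coext_retract_pi_conductor hinj hbir 𝔠 h𝔠 P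
  haveI : Module.Finite C ↥𝔠 := Module.IsNoetherian.finite C _
  exact Module.Finite.of_surjective p fun θ => ⟨i θ, h θ⟩

/-- **`W(P)` is finitely generated projective over `C` when the conductor is a projective `C`-module**
(e.g. an invertible ideal), for `P` finitely generated projective over `B`. [folklore] -/
theorem finite_projective_coext_of_projective [IsDomain C] [IsNoetherianRing C]
    (hinj : Function.Injective (algebraMap B C))
    (hbir : ∀ γ : C, ∃ b : B, b ≠ 0 ∧ ∃ b' : B, algebraMap B C b' = algebraMap B C b * γ)
    (𝔠 : Ideal C) (h𝔠 : ∀ γ : C, γ ∈ 𝔠 ↔ ∀ δ : C, ∃ b : B, algebraMap B C b = γ * δ)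
    [Module.Projective C ↥𝔠]
    (P : Type u) [AddCommGroup P] [Module B P] [Module.Finite B P] [Module.Projective B P] :
    Module.Finite C (((ModuleCat.restrictScalars (algebraMap B C)).obj (ModuleCat.of C C)) →ₗ[B] P) ∧
      Module.Projective C (((ModuleCat.restrictScalars (algebraMap B C)).obj (ModuleCat.of C C)) →ₗ[B] P) := by
  obtain ⟨n, i, p, h⟩ := exists_coext_retract_pi_conductor hinj hbir 𝔠 h𝔠 P
  haveI : Module.Finite C ↥𝔠 := Module.IsNoetherian.finite C _
  haveI : Module.Projective C (Fin n → ↥𝔠) :=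
    Module.Projective.of_equiv (DFinsupp.linearEquivFunOnFintype (R := C) (M := fun _ : Fin n => ↥𝔠))
  exact ⟨Module.Finite.of_surjective p fun θ => ⟨i θ, h θ⟩,
    Module.Projective.of_split i p (LinearMap.ext h)⟩


/-! ## p552596's chain from the single hypothesis «`W` preserves finitely generated projectives» -/

/-- **`W(K)` is a second `C`-syzygy for every second `B`-syzygy `K`**, as soon as `W(P)` is finitely generated
projective over `C` for every finitely generated projective `B`-module `P` (`C` noetherian; left exactness
`W(ker) ≅ ker W` of p552596 + tree `isSyzygy_two_ker`).  Adapted from p552596's `exists_isSyzygy_two_coext`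
(principal conductor). [folklore] -/
theorem exists_isSyzygy_two_coext_of [IsNoetherianRing C]
    (hW : ∀ (P : Type u) [AddCommGroup P] [Module B P], Module.Finite B P → Module.Projective B P →
      Module.Finite C (((ModuleCat.restrictScalars (algebraMap B C)).obj (ModuleCat.of C C)) →ₗ[B] P) ∧
        Module.Projective C (((ModuleCat.restrictScalars (algebraMap B C)).obj (ModuleCat.of C C)) →ₗ[B] P))
    {M K : ModuleCat.{u} B} (hK : IsSyzygy 2 M K) :
    ∃ X : ModuleCat.{u} C, Module.Finite C X ∧
      IsSyzygy 2 X (ModuleCat.of C (((ModuleCat.restrictScalars (algebraMap B C)).obj (ModuleCat.of C C))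
        →ₗ[B] K)) := by
  obtain ⟨K', P, h1, hPfin, hPproj, f, g, w, hS⟩ := hK
  obtain ⟨K'', P', -, hP'fin, hP'proj, f', g', w', hS'⟩ := h1
  haveI := hPfin
  haveI := hP'fin
  haveI : Module.Projective B P := (IsProjective.iff_projective (R := B) P).mpr hPproj
  haveI : Module.Projective B P' := (IsProjective.iff_projective (R := B) P').mpr hP'proj
  have hf : Function.Injective f.hom := (ModuleCat.mono_iff_injective f).mp hS.mono_f
  have hf' : Function.Injective f'.hom := (ModuleCat.mono_iff_injective f').mp hS'.mono_f
  -- `K = ker (f' ∘ g : P → P')`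
  let φ : P →ₗ[B] P' := f'.hom ∘ₗ g.hom
  have hfφ : LinearMap.range f.hom = LinearMap.ker φ := by
    rw [LinearMap.ker_comp_of_ker_eq_bot _ (LinearMap.ker_eq_bot.mpr hf')]
    exact hS.exact.moduleCat_range_eq_ker
  obtain ⟨hWPfin, hWPproj⟩ := hW P inferInstance inferInstance
  obtain ⟨hWP'fin, hWP'proj⟩ := hW P' inferInstance inferInstance
  let Wφ : (((ModuleCat.restrictScalars (algebraMap B C)).obj (ModuleCat.of C C)) →ₗ[B] P) →ₗ[C]
      (((ModuleCat.restrictScalars (algebraMap B C)).obj (ModuleCat.of C C)) →ₗ[B] P') :=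
    { toFun := fun θ => φ ∘ₗ θ
      map_add' := fun θ θ' => LinearMap.comp_add _ _ _
      map_smul' := fun s θ => by apply LinearMap.ext; intro w; rfl }
  obtain ⟨e⟩ := exists_linearEquiv_coext_ker (C := C) f.hom hf φ hfφ Wφ (fun _ => rfl)
  have h2 := isSyzygy_two_ker Wφ
  exact ⟨_, inferInstance, h2.of_iso e.symm.toModuleIso⟩

/-- **Every `y ∈ ca³(C)` factors on `W(K)`** (`K` a second `B`-syzygy, `W` preserving finitely generated
projectives): `y • 𝟙_{W(K)}` factors `C`-linearly through a finite free `C`-module (dimension shifting + dual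
splitting criterion).  Adapted from p552596. [cite: IyengarTakahashi2014, Remark 2.13] -/
theorem exists_coext_factor_of_mem_cohomologyAnnihilatorOfDegree_three_of [IsNoetherianRing C]
    (hW : ∀ (P : Type u) [AddCommGroup P] [Module B P], Module.Finite B P → Module.Projective B P →
      Module.Finite C (((ModuleCat.restrictScalars (algebraMap B C)).obj (ModuleCat.of C C)) →ₗ[B] P) ∧
        Module.Projective C (((ModuleCat.restrictScalars (algebraMap B C)).obj (ModuleCat.of C C)) →ₗ[B] P))
    {y : C} (hy : y ∈ cohomologyAnnihilatorOfDegree C 3)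
    {M K : ModuleCat.{u} B} (hK : IsSyzygy 2 M K) :
    ∃ (m : ℕ)
      (ψ : (((ModuleCat.restrictScalars (algebraMap B C)).obj (ModuleCat.of C C)) →ₗ[B] K) →ₗ[C]
        (Fin m → C))
      (g : (Fin m → C) →ₗ[C] (((ModuleCat.restrictScalars (algebraMap B C)).obj (ModuleCat.of C C))
        →ₗ[B] K)),
      ∀ θ, g (ψ θ) = y • θ := by
  obtain ⟨X, hX, hWK⟩ := exists_isSyzygy_two_coext_of hW hK
  haveI := hX
  haveI : Module.Finite C (((ModuleCat.restrictScalars (algebraMap B C)).obj (ModuleCat.of C C)) →ₗ[B] K) :=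
    finite_of_isSyzygy 2 hX hWK
  obtain ⟨m, q, hq⟩ := Module.Finite.exists_fin' C
    (((ModuleCat.restrictScalars (algebraMap B C)).obj (ModuleCat.of C C)) →ₗ[B] K)
  have hS := LinearMap.shortExact_shortComplexKer hq
  haveI : Module.Finite C (LinearMap.ker q) := Module.IsNoetherian.finite C _
  have hcls : y • hS.extClass = 0 :=
    ext_smul_eq_zero_of_isSyzygy 2 hWK (ModuleCat.of C (LinearMap.ker q)) 1 le_rfl y
      (fun e' => smul_eq_zero_of_mem_cohomologyAnnihilatorOfDegree hy (by omega) e') _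
  obtain ⟨ψ, hψ⟩ := exists_comp_eq_smul_id_X₃_of_smul_extClass_eq_zero hS hcls
  refine ⟨m, ψ.hom, q, fun θ => ?_⟩
  have := congrArg (fun χ => χ.hom θ) hψ
  simpa using this

/-- **The conductor floor from «`W` preserves finitely generated projectives».**  `B → C` injective,
`B`, `C` noetherian; for conductor elements `c, c'` (`c·C ⊆ B`, `c'·C ⊆ B`) and `y ∈ ca³(C)`, the element
`c·b` (`b = c'y` in `C`) lies in `ca³(B)` (CA1 + p551581's transfer + the factorisation above).  Adapted from
p552596's `mul_mem_cohomologyAnnihilatorOfDegree_three_of_conductor`. [cite: IyengarTakahashi2014, Remark 2.13] -/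
theorem mul_mem_cohomologyAnnihilatorOfDegree_three_of_conductor_of [IsNoetherianRing B] [IsNoetherianRing C]
    (hinj : Function.Injective (algebraMap B C))
    (hW : ∀ (P : Type u) [AddCommGroup P] [Module B P], Module.Finite B P → Module.Projective B P →
      Module.Finite C (((ModuleCat.restrictScalars (algebraMap B C)).obj (ModuleCat.of C C)) →ₗ[B] P) ∧
        Module.Projective C (((ModuleCat.restrictScalars (algebraMap B C)).obj (ModuleCat.of C C)) →ₗ[B] P))
    {c c' : B} (hc : ∀ γ : C, ∃ b : B, algebraMap B C b = algebraMap B C c * γ)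
    (hc' : ∀ γ : C, ∃ b : B, algebraMap B C b = algebraMap B C c' * γ)
    {y : C} (hy : y ∈ cohomologyAnnihilatorOfDegree C 3) {b : B}
    (hb : algebraMap B C b = algebraMap B C c' * y) :
    c * b ∈ cohomologyAnnihilatorOfDegree B 3 := by
  refine (mem_cohomologyAnnihilatorOfDegree_succ_iff_forall_isSyzygy (n := 2) (c * b)).mpr
    fun M K hM hK => ?_
  obtain ⟨m, ψ, g, hψg⟩ := exists_coext_factor_of_mem_cohomologyAnnihilatorOfDegree_three_of hW hy hK
  exact stablyAnnihilates_of_coextension_factor hinj hc hc' K hb ψ g hψg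

/-! ## The floor for a PROJECTIVE conductor -/

/-- **THE CONDUCTOR FLOOR FOR A PROJECTIVE CONDUCTOR.**  `B → C` injective and birational, `B`, `C` noetherian,
`C` a domain, the conductor `𝔠 ⊆ C` (`γ ∈ 𝔠 ↔ γ·C ⊆ B`) a PROJECTIVE `C`-module (e.g. invertible); then for
conductor elements `c, c'` and `y ∈ ca³(C)`: `c·(c'y) ∈ ca³(B)`, i.e. `𝔠²·ca³(C) ⊆ ca³(B)`.  p552596 is the
principal case `𝔠 = aC`. [cite: IyengarTakahashi2014, Remark 2.13] -/
theorem mul_mem_cohomologyAnnihilatorOfDegree_three_of_conductor_of_projective [IsNoetherianRing B]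
    [IsDomain C] [IsNoetherianRing C] (hinj : Function.Injective (algebraMap B C))
    (hbir : ∀ γ : C, ∃ b : B, b ≠ 0 ∧ ∃ b' : B, algebraMap B C b' = algebraMap B C b * γ)
    (𝔠 : Ideal C) (h𝔠 : ∀ γ : C, γ ∈ 𝔠 ↔ ∀ δ : C, ∃ b : B, algebraMap B C b = γ * δ)
    [Module.Projective C ↥𝔠]
    {c c' : B} (hc : ∀ γ : C, ∃ b : B, algebraMap B C b = algebraMap B C c * γ)
    (hc' : ∀ γ : C, ∃ b : B, algebraMap B C b = algebraMap B C c' * γ)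
    {y : C} (hy : y ∈ cohomologyAnnihilatorOfDegree C 3) {b : B}
    (hb : algebraMap B C b = algebraMap B C c' * y) :
    c * b ∈ cohomologyAnnihilatorOfDegree B 3 :=
  mul_mem_cohomologyAnnihilatorOfDegree_three_of_conductor_of hinj
    (fun P _ _ _ _ => finite_projective_coext_of_projective hinj hbir 𝔠 h𝔠 P) hc hc' hy hb


end Summit.ResolutionOfSingularities.ResolutionOfSingularities.Theorems.HomologicalConductor.PersistenceConductorFloorGeneral

end
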